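import Mathlib.AlgebraicGeometry.Morphisms.UniversallyOpen
import Literature.AlgebraicGeometry.Motives.SubschemeCyclesRatComponentsProofs
import Literature.AlgebraicGeometry.Motives.SubschemeCyclesBaseChangeProofs
import Literature.AlgebraicGeometry.Motives.SubschemeCyclesFlatPullbackProofs
import HarnessLib

/-!
# Base change of the relative dimension, and the inverse image of a family under `f × 1_T`

Infrastructure for Fulton's Prop. 10.3 (b) (flat pull-back preserves algebraic equivalence;
`Motives/AlgebraicEquivalenceFlatPullbackFiniteTypeProofs`), where a generator
`[W_{t₀}] - [W_{t₁}]` of algebraic equivalence on `Y` (`W ⊆ Y ×ₖ T` a subvariety flat over a smooth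
curve `T`) is pulled back along a flat `f : X → Y` of relative dimension `e` through the flat
morphism `f × 1_T : X ×ₖ T → Y ×ₖ T` and the inverse image scheme `W'' = (f × 1_T)⁻¹(W)` (Fulton,
*Intersection Theory*, 2nd ed. 1998, proof of Theorem 1.7, p. 18: "Let `W = (f × 1)⁻¹(V)` … Let
`W_1, …, W_t` be the irreducible components of `W`"; §1.7, p. 18: "`f⁻¹(V)` … a subscheme of `X` of
pure dimension `dim(V) + n`"; App. B.2.5 for "relative dimension").

* `IsEquidimensional.of_isPullback` (PROVED): the tree's relative-dimension predicate
  `Scheme.Hom.IsEquidimensional f e` (all components of all fibres have dimension `e`, prelude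
  `SubschemeCycles`) is stable under base change, for `f` locally of finite type: a fibre of the base
  change is the base change of a fibre of `f` to a bigger residue field (Mathlib
  `isPullback_fiberToSpecResidueField_of_isPullback`), whose components have the same dimensions
  (`Scheme.height_eq_height_of_length_stalkFiber_ne_top`, `Motives/SubschemeCyclesBaseChangeProofs`,
  Görtz–Wedhorn I Prop. 5.38; a maximal point goes to a maximal point under the flat projection,
  `isMax_apply_of_flat`). Whence `isEquidimensional_whiskerRight_left`: `f × 1_T` has the relative
  dimension of `f` (through the cartesian square `isPullback_whiskerRight_fst`, `X ×ₖ T = X ×_Y (Y ×ₖ T)`).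
* `finite_isMax_pullback_whiskerRight` (PROVED): for `f` flat and quasi-compact, `W''` has finitely
  many irreducible components even when `W` (hence `W''`) is not quasi-compact — they lie over the
  generic point of `W`.
* `dim_ofPoint_comp_pullback_whiskerRight` (PROVED): the components of `W''` have dimension
  `dim W + e` (`height_snd_of_isMax` of `Motives/SubschemeCyclesRatComponentsProofs` for `f × 1_T`).

## References

* W. Fulton, *Intersection Theory*, 2nd ed., Springer (1998), §1.7 (p. 18), Theorem 1.7 and its
  proof (pp. 18–19), §10.3 Prop. 10.3 (b) (p. 167 of the 1984 printing / §10.3), App. B.2.5.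
* U. Görtz, T. Wedhorn, *Algebraic Geometry I*, 2nd ed. (2020), Prop. 4.16, Prop. 5.38.
* The Stacks Project, Tags 02NK (relative dimension and base change), 03HV (generisations lift
  along flat morphisms), 0BE1.
-/

universe u

open CategoryTheory AlgebraicGeometry Limits Order TopologicalSpace IsLocalRing

namespace Literature.AlgebraicGeometry.Motives

/-! ### Flat morphisms and maximal points; relative dimension under base change -/

section MaxFlat

variable {A B : Scheme.{u}}

/-- A flat morphism maps generic points of irreducible components to generic points of
irreducible components: if `a` is maximal for the specialisation order of `A` then so is `π a` in
`B` (generisations lift along flat morphisms, Stacks 03HV, Mathlib `Flat.generalizingMap`).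
[folklore] -/
theorem isMax_apply_of_flat (π : A ⟶ B) [Flat π] {a : A} (ha : IsMax a) : IsMax (π a) := by
  intro b hb
  obtain ⟨a', ha', rfl⟩ := Flat.generalizingMap π (Scheme.le_iff_specializes.mp hb)
  exact Scheme.le_iff_specializes.mpr
    ((Scheme.le_iff_specializes.mp (ha (Scheme.le_iff_specializes.mpr ha'))).map π.continuous)

end MaxFlat

section BaseChange

variable {P X Y Z : Scheme.{u}} {fst : P ⟶ X} {snd : P ⟶ Y} {f : X ⟶ Z} {g : Y ⟶ Z}

/-- **Relative dimension is stable under base change.** For a cartesian square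
`fst ≫ f = snd ≫ g` with `f : X ⟶ Z` locally of finite type and of relative dimension `e` (every
irreducible component of every fibre has dimension `e`), the base change `snd : P ⟶ Y` has relative
dimension `e`: the fibre `P_y` is the base change `X_{g y} ×_{κ(g y)} Spec κ(y)` of the fibre of `f`
(Mathlib `isPullback_fiberToSpecResidueField_of_isPullback`), a maximal point `z` of `P_y` maps to a
maximal point of `X_{g y}` under this flat projection, and the two have the same dimension
(`Scheme.height_eq_height_of_length_stalkFiber_ne_top`: the dimension of the components of a scheme
locally of finite type over a field is invariant under extension of the base field, EGA IV₂ 4.2,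
Görtz–Wedhorn I Prop. 5.38). (Fulton, *Intersection Theory*, App. B.2.5; Stacks 02NK.) [folklore] -/
theorem IsEquidimensional.of_isPullback (h : IsPullback fst snd f g) [LocallyOfFiniteType f]
    {e : ℕ} (he : f.IsEquidimensional e) : snd.IsEquidimensional e := by
  intro y z hz
  haveI : LocallyOfFiniteType snd := MorphismProperty.of_isPullback h ‹_›
  haveI : IsLocallyNoetherian (snd.fiber y) := isLocallyNoetherian_fiber snd y
  haveI : LocallyOfFiniteType (f.fiberToSpecResidueField (g y)) :=
    MorphismProperty.pullback_snd _ _ inferInstance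
  obtain ⟨π, H⟩ : ∃ π : snd.fiber y ⟶ f.fiber (g y), IsPullback π (snd.fiberToSpecResidueField y)
      (f.fiberToSpecResidueField (g y)) (Spec.map (g.residueFieldMap y)) :=
    ⟨_, isPullback_fiberToSpecResidueField_of_isPullback h y⟩
  -- a morphism to the spectrum of a field is flat (Mathlib, low-priority instance
  -- `Flat.instOfSubsingletonCarrierCarrierCommRingCatOfIsIntegral`)
  haveI : Flat (Spec.map (g.residueFieldMap y)) := inferInstance
  haveI : Flat π := MorphismProperty.of_isPullback H.flip ‹_›
  -- `π z` is a maximal point of `X_{g y}`, hence of dimension `e`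
  have hx : height (π z) = e := he (g y) (π z) (isMax_apply_of_flat π hz)
  -- and `height z = height (π z)`
  rw [← hx]
  refine Scheme.height_eq_height_of_length_stalkFiber_ne_top (g.residueFieldMap y).hom
    (f.fiberToSpecResidueField (g y)) π (snd.fiberToSpecResidueField y) ?_ z ?_
  · rw [CommRingCat.ofHom_hom]; exact H
  · -- the local ring of the fibre of `π` at `z` is a quotient of the Artinian ring `𝒪_{P_y, z}`
    rw [length_stalk_fiber π z]
    have hfin := (isGenericComponentPoint_of_isMax hz).ne
    exact fun htop ↦ hfin (eq_top_iff.mpr (htop ▸ Module.length_le_of_surjective _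
      (Submodule.mkQ_surjective _)))

end BaseChange


/-! ### The base change `f × 1_T : X ×ₖ T ⟶ Y ×ₖ T` -/

section WhiskerRight

open MonoidalCategory CartesianMonoidalCategory

variable {k : Type u} [Field k] {X Y : SchemeOver k} (f : X ⟶ Y) (T : SchemeOver k)

/-- **`X ×ₖ T = X ×_Y (Y ×ₖ T)`**: the square with top `pr_X : X ×ₖ T → X`, left
`f × 1_T : X ×ₖ T → Y ×ₖ T`, right `f` and bottom `pr_Y : Y ×ₖ T → Y` is cartesian (pasting of the
two product squares over `Spec k`; Görtz–Wedhorn I, Prop. 4.16). [folklore] -/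
theorem isPullback_whiskerRight_fst :
    IsPullback (fst X T).left (f ▷ T).left f.left (fst Y T).left := by
  have t : IsPullback (fst Y T).left (snd Y T).left Y.hom T.hom := IsPullback.of_hasPullback _ _
  have big : IsPullback (fst X T).left ((f ▷ T).left ≫ (snd Y T).left) (f.left ≫ Y.hom) T.hom := by
    have e₁ : (f ▷ T).left ≫ (snd Y T).left = (snd X T).left := by
      rw [← Over.comp_left, whiskerRight_snd]
    rw [e₁, Over.w f]
    exact IsPullback.of_hasPullback _ _
  refine big.of_bot ?_ t
  rw [← Over.comp_left, ← Over.comp_left, whiskerRight_fst]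

/-- `f × 1_T` is flat when `f` is (base change). Stated as a theorem, used via `haveI`. [folklore] -/
theorem flat_whiskerRight_left [Flat f.left] : Flat (f ▷ T).left :=
  MorphismProperty.of_isPullback (isPullback_whiskerRight_fst f T) ‹_›

/-- `f × 1_T` is locally of finite type when `f` is (base change). Stated as a theorem, used via
`haveI`. [folklore] -/
theorem locallyOfFiniteType_whiskerRight_left [LocallyOfFiniteType f.left] :
    LocallyOfFiniteType (f ▷ T).left :=
  MorphismProperty.of_isPullback (isPullback_whiskerRight_fst f T) ‹_›

/-- `f × 1_T` is quasi-compact when `f` is (base change). Stated as a theorem, used via `haveI`.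
[folklore] -/
theorem quasiCompact_whiskerRight_left [QuasiCompact f.left] : QuasiCompact (f ▷ T).left :=
  MorphismProperty.of_isPullback (isPullback_whiskerRight_fst f T) ‹_›

/-- **`f × 1_T` has the relative dimension of `f`** (its fibre over `(y, t)` is the base change
of `X_y` to `κ(y, t)`; `IsEquidimensional.of_isPullback`). This is what makes
`(f × 1_T)⁻¹(W)` purely `(dim W + e)`-dimensional in the proof of Fulton's Prop. 10.3 (b)
(*Intersection Theory*, §1.7: "`f⁻¹(V)` … a subscheme of pure dimension `dim V + n`"). [folklore] -/
theorem isEquidimensional_whiskerRight_left [LocallyOfFiniteType f.left] {e : ℕ}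
    (he : f.left.IsEquidimensional e) : (f ▷ T).left.IsEquidimensional e :=
  IsEquidimensional.of_isPullback (isPullback_whiskerRight_fst f T) he

/-- Points: `pr_Y ((f × 1_T) z) = f (pr_X z)`. [folklore] -/
lemma fst_whiskerRight_left_apply (z : ↥(X ⊗ T).left) :
    (fst Y T).left ((f ▷ T).left z) = f.left ((fst X T).left z) := by
  rw [← Scheme.Hom.comp_apply, ← Scheme.Hom.comp_apply, ← Over.comp_left, ← Over.comp_left,
    whiskerRight_fst]

/-- Points: `pr_T ((f × 1_T) z) = pr_T z`. [folklore] -/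
lemma snd_whiskerRight_left_apply (z : ↥(X ⊗ T).left) :
    (snd Y T).left ((f ▷ T).left z) = (snd X T).left z := by
  rw [← Scheme.Hom.comp_apply, ← Over.comp_left, whiskerRight_snd]

end WhiskerRight

/-! ### The inverse image family `W'' = (f × 1_T)⁻¹(W) ⊆ X ×ₖ T` and its components -/

section InverseImageFamily

open MonoidalCategory CartesianMonoidalCategory

variable {k : Type u} [Field k] {X Y T : SchemeOver k} (f : X ⟶ Y) [Flat f.left]
  [LocallyOfFiniteType f.left] [QuasiCompact f.left] [LocallyOfFiniteType Y.hom]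
  [LocallyOfFiniteType T.hom] (W : ClosedSubvariety (Y ⊗ T).left)

/-- `Y ×ₖ T → Spec k` is locally of finite type when `Y` and `T` are. [folklore] -/
theorem locallyOfFiniteType_tensorObj_hom_of_lft : LocallyOfFiniteType (Y ⊗ T).hom :=
  inferInstanceAs (LocallyOfFiniteType (pullback.fst Y.hom T.hom ≫ Y.hom))

/-- **Finiteness of the components of `(f × 1_T)⁻¹(W)`** for `f` flat and quasi-compact and `W`
integral (not necessarily quasi-compact): every generic point of a component of
`W'' = W ×_{Y × T} (X × T)` lies over the generic point `ξ` of `W` (flatness, `isMax_pullback`),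
hence in the quasi-compact open `pr⁻¹(U)` for any affine open `U ∋ ξ` of `W`, which is a Noetherian
scheme with finitely many maximal points (`finite_setOf_mem_and_isMax`). (Fulton, *Intersection
Theory*, §1.7: `W_1, …, W_t` "the irreducible components of `W`".) [folklore] -/
theorem finite_isMax_pullback_whiskerRight :
    Finite {η : ↥(pullback W.ι (f ▷ T).left) // IsMax η} := by
  haveI := flat_whiskerRight_left f T
  haveI := quasiCompact_whiskerRight_left f T
  haveI : LocallyOfFiniteType X.hom := by rw [← Over.w f]; infer_instance
  haveI := locallyOfFiniteType_tensorObj_hom_of_lft (Y := Y) (T := T)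
  haveI := locallyOfFiniteType_tensorObj_hom_of_lft (Y := X) (T := T)
  haveI : IsLocallyNoetherian (X ⊗ T).left := LocallyOfFiniteType.isLocallyNoetherian (X ⊗ T).hom
  haveI : IsLocallyNoetherian (Y ⊗ T).left := LocallyOfFiniteType.isLocallyNoetherian (Y ⊗ T).hom
  haveI : IsLocallyNoetherian W.carrier := LocallyOfFiniteType.isLocallyNoetherian W.ι
  haveI : IsLocallyNoetherian (pullback W.ι (f ▷ T).left) :=
    LocallyOfFiniteType.isLocallyNoetherian (pullback.snd W.ι (f ▷ T).left)
  set g := pullback.fst W.ι (f ▷ T).left with hg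
  -- an affine open `U ∋ ξ_W`; `g⁻¹ U` is quasi-compact and contains all maximal points
  obtain ⟨_, ⟨U, hU, rfl⟩, hξU, -⟩ := W.carrier.isBasis_affineOpens.exists_subset_of_mem_open
    (Set.mem_univ (genericPoint W.carrier)) isOpen_univ
  have hfin := finite_setOf_mem_and_isMax (g ⁻¹ᵁ U)
    (QuasiCompact.isCompact_preimage (f := g) _ U.2 hU.isCompact)
  refine Finite.of_injective (fun η : {η // IsMax η} ↦ (⟨η.1, ?_⟩ : hfin.toFinset)) ?_
  · rw [Set.Finite.mem_toFinset]
    refine ⟨?_, η.2⟩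
    change g η.1 ∈ U
    rw [(isMax_pullback (f ▷ T).left W η.1 η.2).2.1]
    exact hξU
  · intro a b h
    exact Subtype.ext (congrArg (fun x : hfin.toFinset ↦ (x : ↥(pullback W.ι (f ▷ T).left))) h)

variable {d e : ℕ} (hW : W.dim = d + 1) (he : f.left.IsEquidimensional e)

omit [QuasiCompact f.left] in
include hW he in
/-- **The components of `(f × 1_T)⁻¹(W)` have dimension `dim W + e`** (Fulton, *Intersection
Theory*, §1.7, "`f⁻¹(V)` is … of pure dimension `dim(V) + n`", applied to the flat morphism
`f × 1_T` of relative dimension `e`, `isEquidimensional_whiskerRight_left`, `height_snd_of_isMax`):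
for a maximal point `η` of `W''`, the closed subvariety `V_η = closure {η} ⊆ X ×ₖ T` has dimension
`(d + e) + 1` when `dim W = d + 1`. [cite: Fulton1998, §1.7] -/
theorem dim_ofPoint_comp_pullback_whiskerRight (η : ↥(pullback W.ι (f ▷ T).left)) (hη : IsMax η) :
    ((ClosedSubvariety.ofPoint _ η).comp (pullback.snd W.ι (f ▷ T).left)).dim = (d + e + 1 : ℕ) := by
  haveI := flat_whiskerRight_left f T
  haveI := locallyOfFiniteType_whiskerRight_left f T
  haveI : LocallyOfFiniteType X.hom := by rw [← Over.w f]; infer_instance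
  haveI := locallyOfFiniteType_tensorObj_hom_of_lft (Y := Y) (T := T)
  haveI := locallyOfFiniteType_tensorObj_hom_of_lft (Y := X) (T := T)
  haveI : IsLocallyNoetherian (X ⊗ T).left := LocallyOfFiniteType.isLocallyNoetherian (X ⊗ T).hom
  haveI : IsLocallyNoetherian (Y ⊗ T).left := LocallyOfFiniteType.isLocallyNoetherian (Y ⊗ T).hom
  haveI : IsLocallyNoetherian W.carrier := LocallyOfFiniteType.isLocallyNoetherian W.ι
  change height (pullback.snd W.ι (f ▷ T).left (ClosedSubvariety.ofPoint _ η).genericPoint) = _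
  rw [ClosedSubvariety.genericPoint_ofPoint,
    height_snd_of_isMax (f ▷ T).left (Y ⊗ T).hom W hW (isEquidimensional_whiskerRight_left f T he) η hη]
  push_cast
  ring

end InverseImageFamily

end Literature.AlgebraicGeometry.Motives
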